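import Mathlib
import HarnessLib
import Summits.Ventures.LatticeQCDFlow.Exactness.U1LeapfrogMeanAcceptance
import Summits.Ventures.LatticeQCDFlow.Exactness.U1WilsonFlowLOExactForceLipschitz
import Summits.Ventures.LatticeQCDFlow.Exactness.U1WilsonFlowLOContinuity
import Summits.Ventures.LatticeQCDFlow.Exactness.U1FTHMCGaugeCovariance

/-!
# `U(1)` rung — THE MEAN ACCEPTANCE OF FT-HMC THROUGH THE LO WILSON-FLOW MEMBER WITH THE EXACT FORCE AS RUN IS `≥ 1 − (explicit)·n·ε'²`: the «acceptance vs step size» law with EVERY constant in closed form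

HONEST FRAMING: exact (Metropolis-corrected) sampling algorithms for lattice gauge theory;
figures of merit are autocorrelation/cost numbers at stated couplings and volumes; no
continuum-physics claim.

Venture `LatticeQCDFlow` (cell pub-lqcd), topic `Exactness`; FANOUT row 14 (`eng-flowhmc`, engine
`latflow.fthmc`, family B, `U(1)` rung: the LO Wilson-flow member `F` (ANY schedule of masked sub-steps), forces
by autodiff of `S̃ = β S_W∘F − log J`, `n` leapfrog steps of size `ε'`, kinetic term `κ'Σp_e²`, consistent half kick
`−D/(4κ')`).  NEW WORK of the cell — the assembly of this row's `U(1)` chain: `U1LeapfrogMeanAcceptance`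
(`u1LeapfrogProposalN_meanAcceptance_ge`: the refresh-averaged acceptance is `≥ 1 − n·K|ε'|·(…)` for ANY action
with a measurable angular derivative bounded by `D_max` and `K`-Lipschitz), `U1WilsonFlowLOExactForceLipschitz`
(`u1WilsonFlowLO_member_exactForce_bounds`: for the LO member the exact force at scale `κ` and drift parameter `c`
is differentiable, bounded by `(1+A)^{n_s}(b₀ + n_s u)` and Lipschitz with constant
`(1+A)^{2n_s}(K₀ + n_s(4A(b₀ + n_s u) + w))`, ALL EXPLICIT — here at `κ = 1`, `c = ε'`),
`U1WilsonFlowLOContinuity` (`u1WilsonFlowLO_member_ftAction_continuous`), `U1FTHMCGaugeCovariance`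
(`measurable_u1ExactForce`), `U1MomentumLawMoments`; nothing is cited as a fact; no number.

* **`u1WilsonFlowLO_member_exactForce_meanAcceptance_ge`** — `L ≥ 2`, `2(d−1)|ε| < 1`, ANY schedule `sched` of
  `n_s` sub-steps (layers VERBATIM, positive densities), every `β`, `ε'`, `κ' > 0`, `n`, EVERY configuration `q`:
  with `A = 8(d−1)|ε|`, `m = 1 − 2(d−1)|ε|`,
  `D_max = (1+A)^{n_s}·(2(d−1)|β||ε'| + n_s·|ε'||ε|·8(d−1)/m)`,
  `K = (1+A)^{2n_s}·(8(d−1)|β||ε'| + n_s·(4A·(2(d−1)|β||ε'| + n_s·|ε'||ε|·8(d−1)/m) + |ε'||ε|·(32(d−1)/m + 64(d−1)²|ε|/m²)))`,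
  `b = (2n+1)D_max/(4κ')`, `c₁ = (2n+1)|E|D_max/(4κ')`, `c₂ = |E|D_max/(8κ')`:
  `∫ min(1, e^{−ΔH(q,p)}) d(u1MomentumLaw κ')(p) ≥ 1 − n·K|ε'|·(|E|²/(2κ') + (b + c₁ + c₂)·|E|/√(πκ') + b(c₁ + c₂))`.
  `D_max` and `K` each carry one factor `|ε'|`, so the acceptance deficit is `O(n·ε'²)` with the constant in closed
  form in `(d, |E|, β, ε, ε', κ', n, n_s)` — nothing left unevaluated.

NOT CLAIMED: sharpness (crude incidence constants, a pointwise law: the deficit grows like `|E|²`); `L = 1`; the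
`SU(2)` rung with explicit constants (there `Φ_max`, `K_Φ` are compactness constants); floating point; any number.
-/

noncomputable section

namespace Summit.Ventures.LatticeQCDFlow.Exactness

open Set Function MeasureTheory
open Literature.MathematicalPhysics.QuantumFieldTheory Literature.MathematicalPhysics.QuantumLattice
open scoped ENNReal

section Member

variable {d L : ℕ} {X : Type*} [DecidableEq X] (χ : Site d L → X) [NeZero L]

/-- **THE MEAN ACCEPTANCE OF FT-HMC THROUGH THE `U(1)` LO WILSON-FLOW MEMBER WITH THE EXACT FORCE AS RUN — EVERY
CONSTANT EXPLICIT.**  Torus `(ℤ/L)^d` with `L ≥ 2`, colouring `χ`, flow step `2(d−1)|ε| < 1`, ANY schedule `sched`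
of `n_s` masked LO sub-steps (layers packaged VERBATIM as in `exists_layers_u1WilsonFlowLO`, positive densities),
every `β`, leapfrog step `ε'`, kinetic coefficient `κ' > 0`, number of steps `n`, EVERY configuration `q`: with
`A = 8(d−1)|ε|`, `m = 1 − 2(d−1)|ε|`,
`D_max = (1+A)^{n_s}·(2(d−1)|β||ε'| + n_s·|ε'||ε|·8(d−1)/m)`,
`K = (1+A)^{2n_s}·(8(d−1)|β||ε'| + n_s·(4A·(2(d−1)|β||ε'| + n_s·|ε'||ε|·8(d−1)/m) + |ε'||ε|(32(d−1)/m + 64(d−1)²|ε|/m²)))`,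
`b = (2n+1)D_max/(4κ')`, `c₁ = (2n+1)|E|D_max/(4κ')`, `c₂ = |E|D_max/(8κ')`, the refresh-averaged Metropolis
acceptance of the engine's `n`-step proposal with drift `e^{iε'p}` and the consistent half kick `−D/(4κ')`
(`D_e(W) = ∂_{θ_e} S̃(e^{iε'θ}·W)|₀`, `S̃ = β S_W∘F − log J`) satisfies
`∫ min(1, e^{−ΔH(q,p)}) d(u1MomentumLaw κ')(p) ≥ 1 − n·K|ε'|·(|E|²/(2κ') + (b + c₁ + c₂)·|E|/√(πκ') + b(c₁ + c₂))`.
Since `D_max`, `K` carry a factor `|ε'|`, the deficit is `O(n·ε'²)` — the «acceptance vs step size» law of the row on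
the `U(1)` rung, with no unevaluated constant. -/
theorem u1WilsonFlowLO_member_exactForce_meanAcceptance_ge (hL : 2 ≤ L) {ε : ℝ}
    (hε : |ε| * (2 * ((d - 1 : ℕ) : ℝ)) < 1) (sched : List (Fin d × X))
    (layers : List ((GaugeConfig d L Circle ≃ᵐ GaugeConfig d L Circle) × (GaugeConfig d L Circle → ℝ)))
    (hmap :
      layers.map (fun Ly => ((Ly.1 : GaugeConfig d L Circle → GaugeConfig d L Circle), Ly.2)) = sched.map (fun s =>
        ((fun (V : GaugeConfig d L Circle) (e : Edge d L) => if e.2 = s.1 ∧ χ e.1 = s.2 then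
          V e * Circle.exp (ε * ∑ ν ∈ Finset.univ.erase e.2,
            (((plaquetteHolonomy V (e.1 - Pi.single ν 1) e.2 ν : Circle) : ℂ).im -
              ((plaquetteHolonomy V e.1 e.2 ν : Circle) : ℂ).im)) else V e),
         fun V : GaugeConfig d L Circle => ∏ a : {e : Edge d L // e.2 = s.1 ∧ χ e.1 = s.2},
          (1 - ε * ∑ ν ∈ Finset.univ.erase a.1.2,
            (((plaquetteHolonomy V a.1.1 a.1.2 ν : Circle) : ℂ).re +
              ((plaquetteHolonomy V (a.1.1 - Pi.single ν 1) a.1.2 ν : Circle) : ℂ).re)))))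
    (hpos : ∀ Ly ∈ layers, ∀ V, 0 < Ly.2 V) (β ε' κ' : ℝ) (hκ' : 0 < κ') (q : GaugeConfig d L Circle) (n : ℕ) :
    let Dmax : ℝ := (1 + 8 * ((d - 1 : ℕ) : ℝ) * |ε|) ^ sched.length *
        (2 * ((d - 1 : ℕ) : ℝ) * (|β| * |ε'|) + (sched.length : ℝ) *
          (|ε'| * |ε| * (8 * ((d - 1 : ℕ) : ℝ)) / (1 - |ε| * (2 * ((d - 1 : ℕ) : ℝ)))))
    let K : ℝ := (1 + 8 * ((d - 1 : ℕ) : ℝ) * |ε|) ^ (2 * sched.length) *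
        (8 * ((d - 1 : ℕ) : ℝ) * (|β| * |ε'|) + (sched.length : ℝ) *
          (4 * (8 * ((d - 1 : ℕ) : ℝ) * |ε|) *
            (2 * ((d - 1 : ℕ) : ℝ) * (|β| * |ε'|) + (sched.length : ℝ) *
              (|ε'| * |ε| * (8 * ((d - 1 : ℕ) : ℝ)) / (1 - |ε| * (2 * ((d - 1 : ℕ) : ℝ))))) +
           |ε'| * |ε| * (32 * ((d - 1 : ℕ) : ℝ) / (1 - |ε| * (2 * ((d - 1 : ℕ) : ℝ))) +
             64 * ((d - 1 : ℕ) : ℝ) ^ 2 * |ε| / (1 - |ε| * (2 * ((d - 1 : ℕ) : ℝ))) ^ 2)))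
    1 - n * (K * |ε'|) *
        ((Fintype.card (Edge d L) : ℝ) ^ 2 * (1 / (2 * κ')) +
          ((2 * n + 1) * (Dmax / (4 * κ')) + (2 * n + 1) * (Fintype.card (Edge d L) * (Dmax / (4 * κ'))) +
              Fintype.card (Edge d L) * Dmax / (8 * κ')) * (Fintype.card (Edge d L) * (1 / Real.sqrt (Real.pi * κ'))) +
          (2 * n + 1) * (Dmax / (4 * κ')) * ((2 * n + 1) * (Fintype.card (Edge d L) * (Dmax / (4 * κ'))) + Fintype.card (Edge d L) * Dmax / (8 * κ'))) ≤
      ∫ p, min 1 (Real.exp (-((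
          (fun W : GaugeConfig d L Circle => β * wilsonAction u1Rep ((layers.foldr (fun Ly (F : GaugeConfig d L Circle ≃ᵐ GaugeConfig d L Circle) => Ly.1.trans F) (MeasurableEquiv.refl (GaugeConfig d L Circle))) W) - Real.log ((layers.foldr (fun Ly K => fun v => Ly.2 v * K (Ly.1 v)) (fun _ => (1 : ℝ))) W))
            (u1LeapfrogProposalN ε' (fun (W : GaugeConfig d L Circle) (e : Edge d L) => -(1 / (4 * κ')) * fderiv ℝ (fun θ : (Edge d L → ℝ) =>
              (fun W : GaugeConfig d L Circle => β * wilsonAction u1Rep ((layers.foldr (fun Ly (F : GaugeConfig d L Circle ≃ᵐ GaugeConfig d L Circle) => Ly.1.trans F) (MeasurableEquiv.refl (GaugeConfig d L Circle))) W) - Real.log ((layers.foldr (fun Ly K => fun v => Ly.2 v * K (Ly.1 v)) (fun _ => (1 : ℝ))) W))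
                ((fun i : Edge d L => Circle.exp (ε' * θ i)) * W)) 0 (Pi.single e 1)) n (q, p)).1 +
          u1Kinetic κ' (u1LeapfrogProposalN ε' (fun (W : GaugeConfig d L Circle) (e : Edge d L) => -(1 / (4 * κ')) * fderiv ℝ (fun θ : (Edge d L → ℝ) =>
              (fun W : GaugeConfig d L Circle => β * wilsonAction u1Rep ((layers.foldr (fun Ly (F : GaugeConfig d L Circle ≃ᵐ GaugeConfig d L Circle) => Ly.1.trans F) (MeasurableEquiv.refl (GaugeConfig d L Circle))) W) - Real.log ((layers.foldr (fun Ly K => fun v => Ly.2 v * K (Ly.1 v)) (fun _ => (1 : ℝ))) W))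
                ((fun i : Edge d L => Circle.exp (ε' * θ i)) * W)) 0 (Pi.single e 1)) n (q, p)).2) -
        ((fun W : GaugeConfig d L Circle => β * wilsonAction u1Rep ((layers.foldr (fun Ly (F : GaugeConfig d L Circle ≃ᵐ GaugeConfig d L Circle) => Ly.1.trans F) (MeasurableEquiv.refl (GaugeConfig d L Circle))) W) - Real.log ((layers.foldr (fun Ly K => fun v => Ly.2 v * K (Ly.1 v)) (fun _ => (1 : ℝ))) W)) q
          + u1Kinetic κ' p)))) ∂(u1MomentumLaw (ι := Edge d L) κ') := by
  intro Dmax K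
  -- the member's exact force at scale 1 with drift parameter ε': differentiable, bounded by Dmax, K-Lipschitz
  obtain ⟨hd, hB, hK⟩ := u1WilsonFlowLO_member_exactForce_bounds χ hL hε sched layers hmap hpos β ε' 1
  have hm : 0 < 1 - |ε| * (2 * ((d - 1 : ℕ) : ℝ)) := by linarith
  have hD0 : 0 ≤ Dmax := by positivity
  have hK0 : 0 ≤ K := by positivity
  -- continuity of S̃, measurability of S̃ and of the exact force
  have hS0c : Continuous fun U : GaugeConfig d L Circle => β * wilsonAction u1Rep U :=
    continuous_smul_wilsonAction u1Rep continuous_u1Rep β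
  have hSc := u1WilsonFlowLO_member_ftAction_continuous χ ε sched layers hmap hpos hS0c
  have hDm := measurable_u1ExactForce hSc ε' 1
  simp only [one_mul, mul_one, abs_one, abs_mul] at hDm hB hK
  exact u1LeapfrogProposalN_meanAcceptance_ge
    (fun W : GaugeConfig d L Circle => β * wilsonAction u1Rep ((layers.foldr (fun Ly (F : GaugeConfig d L Circle ≃ᵐ GaugeConfig d L Circle) => Ly.1.trans F) (MeasurableEquiv.refl (GaugeConfig d L Circle))) W) - Real.log ((layers.foldr (fun Ly K => fun v => Ly.2 v * K (Ly.1 v)) (fun _ => (1 : ℝ))) W))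
    ε' κ' hκ' hSc.measurable hd hD0 hK0 hDm hB hK q n

end Member

end Summit.Ventures.LatticeQCDFlow.Exactness
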